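/-
Copyright (c) 2026. All rights reserved.
Released under Apache 2.0 license as described in the file LICENSE.
Authors: abc-iut cell, prover seat abc-iut-L6-t14 (wave 2).
-/
import Mathlib.NumberTheory.Padics.PadicIntegers
import Literature.AnabelianGeometry.AbsoluteAnabelian.AbsTopII.PositiveSlopeHensel
import HarnessLib

/-!
# `positiveSlopeHensel_polynomial` is false as typed (missing continuity hypothesis)

The named fact `Literature.AnabelianGeometry.AbsoluteAnabelian.positiveSlopeHensel_polynomial`
(`AbsTopII/PositiveSlopeHensel.lean`, the polynomial / `k' = k` special case of [AbsTopII] Lemma 2.1,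
S. Mochizuki, *Topics in Absolute Anabelian Geometry II* (2013), p. 31) quantifies over ARBITRARY
polynomials `fⱼ ∈ O[X₁,…,X_m]` but asks for a centre `β₀ ∈ 𝔪^n` and preimages `x ∈ 𝔪^m`.  In print
the map `φ : B = 𝒪_k[[Y]] → A = 𝒪_k[[X]]`, `Yⱼ ↦ fⱼ`, is a CONTINUOUS `𝒪_k`-algebra homomorphism,
which forces `fⱼ(0) ∈ 𝔪_k` (the `fⱼ` are topologically nilpotent); the typed special case dropped
this condition, and without it the statement fails already for `m = n = 1`, `f = X + 1` over
`O = ℤ_p`: the Jacobian is `1`, but `f(x) = x + 1` is a unit for every `x ∈ 𝔪`, so no ball around a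
point of `𝔪` is in the image of `𝔪`.

This file records the counterexample as a kernel theorem, so that the fact is not taken as a
hypothesis anywhere; the repaired statement adds `∀ j, MvPolynomial.constantCoeff (f j) ∈ 𝔪`
(equivalently: `φ` continuous), under which the lemma is the classical multivariate Newton–Hensel
iteration with a generically invertible Jacobian.
-/

namespace Literature.AnabelianGeometry.AbsoluteAnabelian

open MvPolynomial IsLocalRing

/-- **`positiveSlopeHensel_polynomial` is false as typed.**  Counterexample: `O = ℤ_2`
(a complete discrete valuation ring), `m = n = 1`, `f₀ = X₀ + 1`; the `1 × 1` Jacobian minor is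
`∂f₀/∂X₀ = 1 ≠ 0`, yet for any centre `β₀ ∈ 𝔪` the point `β' := β₀` itself has no preimage
`x ∈ 𝔪`, since `x + 1 = β₀ ∈ 𝔪` would put `1 = β₀ - x` in the maximal ideal.  The printed
[AbsTopII] Lemma 2.1 (p. 31) is about a CONTINUOUS homomorphism `𝒪_k[[Y]] → 𝒪_k[[X]]`, i.e.
`fⱼ(0) ∈ 𝔪_k`, which the typed special case omits. [cite: MochizukiAbsTopII2013, Lemma 2.1 p.31] -/
theorem not_positiveSlopeHensel_polynomial : ¬ positiveSlopeHensel_polynomial := by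
  intro h
  -- the instance: `O = ℤ_[2]`, one variable, one equation `f₀ = X₀ + 1`
  haveI : Fact (Nat.Prime 2) := ⟨Nat.prime_two⟩
  have hJ : ∃ S : Fin 1 ↪ Fin 1,
      (Matrix.of fun j k : Fin 1 =>
        MvPolynomial.pderiv (S k) ((fun _ : Fin 1 => (X 0 + C 1 : MvPolynomial (Fin 1) ℤ_[2])) j)).det
        ≠ 0 := by
    refine ⟨Function.Embedding.refl (Fin 1), ?_⟩
    rw [Matrix.det_unique]
    simp
  obtain ⟨β₀, r, hβ₀, -, H⟩ := h ℤ_[2] 1 1 (fun _ => X 0 + C 1) hJ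
  -- take `β' := β₀` itself
  obtain ⟨x, hx, hfx⟩ := H β₀ (fun j => by rw [sub_self]; exact Ideal.zero_mem _)
  have hx0 : x 0 ∈ maximalIdeal ℤ_[2] := hx 0
  have hβ : β₀ 0 ∈ maximalIdeal ℤ_[2] := hβ₀ 0
  have heval : MvPolynomial.eval x (X 0 + C 1 : MvPolynomial (Fin 1) ℤ_[2]) = x 0 + 1 := by simp
  have h1 : (1 : ℤ_[2]) = β₀ 0 - x 0 := by
    have := hfx 0
    rw [heval] at this
    linear_combination this
  have hone : (1 : ℤ_[2]) ∈ maximalIdeal ℤ_[2] := by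
    rw [h1]
    exact Ideal.sub_mem _ hβ hx0
  exact (Ideal.ne_top_iff_one _).mp (maximalIdeal.isMaximal ℤ_[2]).ne_top hone

end Literature.AnabelianGeometry.AbsoluteAnabelian
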